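import Literature.Analysis.OperatorTheory.PositiveKernelEigenfunction
import Literature.Probability.LatticeModels.MarkovChainMeasure
import Literature.MathematicalPhysics.KineticTheory.InfiniteChainMarkovGibbs
import Literature.MathematicalPhysics.KineticTheory.InfiniteChainMarkovShift
import Literature.MathematicalPhysics.KineticTheory.InfiniteChainMarkovSuperstable
import Summits.AtomisticToContinuum.FouriersLaw.Theorems.EmbeddedDrudeMourreMourreDissolutionGibbsReflection

/-!
# `EmbeddedDrudeMourre.MourreDissolution`, line `separable-vertex-faddeev-pair-sector` —
# Gibbs-state stub (H): EXISTENCE of the symmetric superstable Gibbs state of the pinned chain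

Item `stmt-AtomisticToContinuum-12594` (crux `MourreDissolution` of route `EmbeddedDrudeMourre`,
sub-problem `FouriersLaw`). The registered infrastructure stub `stub_gibbsClustering` asks first
for a measure `μ` on `ℤ → ℝ × ℝ` which is a DLR Gibbs state of `pinnedChain ω₂ lam β γ` at
temperature `T > 0` (`OscillatorChain.IsChainGibbsMeasure`), translation invariant
(`IsShiftInvariant`), superstable in Buttà–Marchioro's sense (`HasSuperstabilityEstimate`, BM
(2.3)) and invariant under the spatial reflection `(ι σ)_x = σ_{-x}`. This file PROVES that static
half (Lebowitz–Presutti 1976 / Ruelle 1976 / Cassandro–Olivieri–Pellegrinotti–Presutti 1978 §2, by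
the transfer-operator construction of Georgii 2011, Thm 10.25 / §11.1), assembling the tree's
bricks:

* transfer data of a chain `P` at `T > 0` (§1): one-site weight `w(q,p) = e^{-(p²/2+U(q))/T}`,
  bond kernel `k((q,p),(q',p')) = e^{-V(q'-q)/T}` — measurable, symmetric (`V` even), `k ≤ 1`
  (`V ≥ 0`), and the Boltzmann weight factorises, `e^{-H_Λ/T} = ∏_{x∈Λ} w ∏_{y∈bondSet Λ} k`;
* `exists_transferEigenData` (§2): Jentzsch's theorem in pointwise `lintegral` form (tree:
  `Literature.Analysis.OperatorTheory.exists_pointwise_eigenfunction_lintegral`, applied on the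
  finite measure space `(ℝ × ℝ, w · Leb)`) gives a bounded measurable `φ > 0` and `0 < L < ∞` with
  `∫⁻ k(z, y) φ(y) w(y) dy = L φ(z)` for every `z` and `∫⁻ φ² w = 1` — exactly the hypotheses
  `heig`, `hnorm` of `Literature.Probability.LatticeModels.exists_markovChainMeasure`;
* `exists_gibbsState` (§3): the two-sided stationary Markov chain `μ` of these data
  (`exists_markovChainMeasure`, Kolmogorov extension) is a DLR state
  (`isChainGibbsMeasure_of_windowDensity`), shift invariant (`isShiftInvariant_of_windowDensity`),
  superstable (`hasSuperstabilityEstimate_of_windowDensity`) and reflection invariant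
  (`map_reflect_eq_of_windowDensity`, this line's previous brick); hypotheses: `U, V` measurable,
  `U, V ≥ 0`, `V` even, `T > 0`, `∫ e^{-U/(2T)} dq < ∞`;
* `exists_gibbsState_pinnedChain` (§4, registered helper stub, one line): the instance for
  `pinnedChain ω₂ lam β γ`, `ω₂ > 0`, `lam, β ≥ 0`, every `T > 0`.

Relation to the tree: `OscillatorChain.exists_isChainGibbsMeasure_hasSuperstabilityEstimate`
(`InfiniteChainGibbsExistence.lean`, seat of crux 12597, landed while this file was written) runs
the same construction but concludes only `∃ μ, IsChainGibbsMeasure ∧ HasSuperstabilityEstimate`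
(for continuous `U, V`); the stub of THIS line needs translation AND reflection invariance of the
SAME `μ`, which cannot be read off an existential statement — hence the four-property theorem
here (from measurable `U, V`), with the eigen-data step exported separately
(`exists_transferEigenData`) for reuse.

What remains of `stub_gibbsClustering` after this file is purely dynamical (F2): summable
space-time covariances of `j₀, h₀` under the Buttà–Marchioro flow and their continuity at `t = 0`.
-/

noncomputable section

namespace Summit.AtomisticToContinuum.FouriersLaw.Theorems.MourreDissolution

open MeasureTheory Set Function Finset Literature.Probability.LatticeModels
open Literature.MathematicalPhysics.KineticTheory.HeatConduction
open scoped ENNReal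

/-! ## §1. The transfer data of a chain -/

section TransferData

variable {P : OscillatorChain} {T : ℝ} {k : ℝ × ℝ → ℝ × ℝ → ℝ≥0∞} {w : ℝ × ℝ → ℝ≥0∞}

/-- The bond kernel `k(z, z') = e^{-V(q'-q)/T}` is jointly measurable (`V` measurable). [folklore] -/
theorem measurable_uncurry_transferKernel (hV : Measurable P.V)
    (hk : ∀ z z', k z z' = ENNReal.ofReal (Real.exp (-T⁻¹ * P.V (z'.1 - z.1)))) :
    Measurable (uncurry k) := by
  have h : uncurry k = fun zz : (ℝ × ℝ) × (ℝ × ℝ) =>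
      ENNReal.ofReal (Real.exp (-T⁻¹ * P.V (zz.2.1 - zz.1.1))) := by
    funext zz; rcases zz with ⟨z, z'⟩; exact hk z z'
  rw [h]
  exact ENNReal.measurable_ofReal.comp (Real.measurable_exp.comp
    ((hV.comp ((measurable_fst.comp measurable_snd).sub
      (measurable_fst.comp measurable_fst))).const_mul _))

/-- The bond kernel is symmetric when `V` is even. [folklore] -/
theorem transferKernel_symm (hVe : ∀ r, P.V (-r) = P.V r)
    (hk : ∀ z z', k z z' = ENNReal.ofReal (Real.exp (-T⁻¹ * P.V (z'.1 - z.1)))) (z y : ℝ × ℝ) :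
    k z y = k y z := by
  rw [hk, hk, ← hVe (z.1 - y.1), neg_sub]

/-- The one-site weight `w(q, p) = e^{-(p²/2+U(q))/T}` is measurable (`U` measurable). [folklore] -/
theorem measurable_siteWeightE (hU : Measurable P.U)
    (hw : ∀ z, w z = ENNReal.ofReal (Real.exp (-T⁻¹ * (z.2 ^ 2 / 2 + P.U z.1)))) :
    Measurable w := by
  have h : w = fun z : ℝ × ℝ => ENNReal.ofReal (Real.exp (-T⁻¹ * (z.2 ^ 2 / 2 + P.U z.1))) :=
    funext hw
  rw [h]
  exact ENNReal.measurable_ofReal.comp (Real.measurable_exp.comp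
    ((((measurable_snd.pow_const 2).div_const 2).add (hU.comp measurable_fst)).const_mul _))

/-- Factorisation of the Boltzmann weight in transfer form,
`e^{-H_Λ(σ)/T} = ∏_{x∈Λ} w(σ_x) · ∏_{y∈bondSet Λ} k(σ_y, σ_{y+1})` (the hypothesis `hfac` of the
tree's `isChainGibbsMeasure_of_windowDensity`; private copy, in the `w`/`k` variables, of the tree's
`OscillatorChain.ofReal_exp_neg_hamiltonianIn`). [cite: LanfordLebowitzLieb1977, §4 eq. (14)] -/
private theorem boltzmannWeight_eq_prod_transfer (P : OscillatorChain) (T : ℝ)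
    {k : ℝ × ℝ → ℝ × ℝ → ℝ≥0∞} {w : ℝ × ℝ → ℝ≥0∞}
    (hw : ∀ z, w z = ENNReal.ofReal (Real.exp (-T⁻¹ * (z.2 ^ 2 / 2 + P.U z.1))))
    (hk : ∀ z z', k z z' = ENNReal.ofReal (Real.exp (-T⁻¹ * P.V (z'.1 - z.1))))
    (Λ : Finset ℤ) (σ : ChainConfig) :
    ENNReal.ofReal (Real.exp (-T⁻¹ * hamiltonianIn P.chainPotential OscillatorChain.chainSupp Λ σ)) =
      (∏ x ∈ Λ, w (σ x)) * ∏ y ∈ OscillatorChain.bondSet Λ, k (σ y) (σ (y + 1)) := by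
  rw [OscillatorChain.hamiltonianIn_chain, mul_add, Finset.mul_sum, Finset.mul_sum, Real.exp_add,
    Real.exp_sum, Real.exp_sum,
    ENNReal.ofReal_mul (Finset.prod_nonneg fun _ _ => (Real.exp_pos _).le),
    ENNReal.ofReal_prod_of_nonneg fun _ _ => (Real.exp_pos _).le,
    ENNReal.ofReal_prod_of_nonneg fun _ _ => (Real.exp_pos _).le]
  congr 1
  · exact Finset.prod_congr rfl fun x _ => (hw (σ x)).symm
  · exact Finset.prod_congr rfl fun y _ => (hk (σ y) (σ (y + 1))).symm

/-! ## §2. Transfer eigen-data (Jentzsch) in window-density form -/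

/-- **Transfer eigen-data of the chain.** Let `U`, `V` be measurable, `V ≥ 0` even, `T > 0` and
`∫ e^{-U/T} dq < ∞`. On the finite measure space `(ℝ × ℝ, ρ_T = w · Leb)` the bond kernel
`K(z, z') = e^{-V(q'-q)/T}` is bounded (`≤ 1`), symmetric and strictly positive, so Jentzsch's
theorem (tree: `exists_pointwise_eigenfunction_lintegral`) yields `λ₀ > 0` and a bounded measurable
`h > 0` with `∫ K(z, y) h(y) dρ_T(y) = λ₀ h(z)` at every point and `∫ h² dρ_T = 1`; with
`φ = ofReal ∘ h`, `L = ofReal λ₀` these are the hypotheses `heig`, `hnorm` (and the bound `φ ≤ B`)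
of the window-density construction (`exists_markovChainMeasure`,
`hasSuperstabilityEstimate_of_windowDensity`). (Cassandro–Olivieri–Pellegrinotti–Presutti 1978, §2;
Reed–Simon IV Thm XIII.43.) [cite: ReedSimonIV1978, Thm XIII.43 and Thm XIII.44] -/
theorem exists_transferEigenData (hU : Measurable P.U) (hV : Measurable P.V)
    (hV0 : ∀ r, 0 ≤ P.V r) (hVe : ∀ r, P.V (-r) = P.V r) (hT : 0 < T)
    (hUi : Integrable (fun q : ℝ => Real.exp (-T⁻¹ * P.U q)))
    (hw : ∀ z, w z = ENNReal.ofReal (Real.exp (-T⁻¹ * (z.2 ^ 2 / 2 + P.U z.1))))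
    (hk : ∀ z z', k z z' = ENNReal.ofReal (Real.exp (-T⁻¹ * P.V (z'.1 - z.1)))) :
    ∃ (φ : ℝ × ℝ → ℝ≥0∞) (L : ℝ≥0∞) (B : ℝ), Measurable φ ∧ L ≠ 0 ∧ L ≠ ∞ ∧
      (∀ z, φ z ≤ ENNReal.ofReal B) ∧
      (∀ z, ∫⁻ y, k z y * φ y * w y = L * φ z) ∧ ∫⁻ y, φ y ^ 2 * w y = 1 := by
  -- the finite one-particle measure `ρ_T = w · Leb` on `ℝ × ℝ`
  have hwm : Measurable w := measurable_siteWeightE hU hw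
  set ρ : Measure (ℝ × ℝ) := (volume : Measure (ℝ × ℝ)).withDensity w with hρ
  have hwf : w = fun z : ℝ × ℝ => ENNReal.ofReal (Real.exp (-T⁻¹ * (z.2 ^ 2 / 2 + P.U z.1))) :=
    funext hw
  haveI : IsFiniteMeasure ρ := by
    rw [hρ, hwf]
    exact isFiniteMeasure_withDensity_ofReal (P.integrable_siteWeight hT hUi).hasFiniteIntegral
  have hρ0 : ρ ≠ 0 := by
    intro h0
    rw [hρ, withDensity_eq_zero_iff hwm.aemeasurable] at h0
    have h1 : (volume : Measure (ℝ × ℝ)) {z | w z ≠ 0} = 0 := ae_iff.1 h0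
    have h2 : {z : ℝ × ℝ | w z ≠ 0} = univ := by
      ext z
      simp only [mem_setOf_eq, mem_univ, iff_true, hw, ne_eq, ENNReal.ofReal_eq_zero, not_le]
      exact Real.exp_pos _
    rw [h2] at h1
    exact (isOpen_univ.measure_pos (volume : Measure (ℝ × ℝ)) univ_nonempty).ne' h1
  -- the real kernel
  set K : ℝ × ℝ → ℝ × ℝ → ℝ := fun z z' => Real.exp (-T⁻¹ * P.V (z'.1 - z.1)) with hK
  have hKm : StronglyMeasurable (uncurry K) := by
    refine Measurable.stronglyMeasurable ?_
    exact Real.measurable_exp.comp ((hV.comp ((measurable_fst.comp measurable_snd).sub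
      (measurable_fst.comp measurable_fst))).const_mul _)
  have hKpos : ∀ z y, 0 < K z y := fun z y => Real.exp_pos _
  have hK1 : ∀ z y, ‖K z y‖ ≤ 1 := fun z y => by
    rw [Real.norm_eq_abs, abs_of_pos (hKpos z y)]
    refine Real.exp_le_one_iff.2 ?_
    have := mul_nonneg (inv_nonneg.2 hT.le) (hV0 (y.1 - z.1))
    show -T⁻¹ * P.V (y.1 - z.1) ≤ 0
    linarith
  have hKsymm : ∀ z y, K z y = K y z := fun z y => by
    show Real.exp (-T⁻¹ * P.V (y.1 - z.1)) = Real.exp (-T⁻¹ * P.V (z.1 - y.1))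
    rw [← hVe (z.1 - y.1), neg_sub]
  -- Jentzsch
  obtain ⟨lam, h, B, hlam, hhm, hhpos, hhle, heig, hnorm⟩ :=
    Literature.Analysis.OperatorTheory.exists_pointwise_eigenfunction_lintegral
      (μ := ρ) hKm hK1 hKsymm hKpos hρ0
  have hkK : ∀ z y, k z y = ENNReal.ofReal (K z y) := fun z y => hk z y
  refine ⟨fun z => ENNReal.ofReal (h z), ENNReal.ofReal lam, B,
    ENNReal.measurable_ofReal.comp hhm, ?_, ENNReal.ofReal_ne_top,
    fun z => ENNReal.ofReal_le_ofReal (hhle z), fun z => ?_, ?_⟩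
  · exact (ENNReal.ofReal_pos.2 hlam).ne'
  · -- the eigen-equation: `∫⁻ k φ w dLeb = ∫⁻ k φ dρ = ofReal (λ₀ h z)`
    have hmeas : Measurable fun y => k z y * ENNReal.ofReal (h y) := by
      refine Measurable.mul ?_ (ENNReal.measurable_ofReal.comp hhm)
      have : k z = fun y => ENNReal.ofReal (K z y) := funext (hkK z)
      rw [this]
      exact ENNReal.measurable_ofReal.comp
        (Real.measurable_exp.comp ((hV.comp (measurable_fst.sub measurable_const)).const_mul _))
    have h1 : ∫⁻ y, k z y * ENNReal.ofReal (h y) * w y =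
        ∫⁻ y, k z y * ENNReal.ofReal (h y) ∂ρ := by
      rw [hρ, lintegral_withDensity_eq_lintegral_mul _ hwm hmeas]
      exact lintegral_congr fun y => by simp only [Pi.mul_apply]; ring
    rw [h1]
    simp_rw [hkK]
    rw [heig z, ENNReal.ofReal_mul hlam.le]
  · -- the normalisation
    have hmeas : Measurable fun y => ENNReal.ofReal (h y) ^ 2 :=
      (ENNReal.measurable_ofReal.comp hhm).pow_const 2
    have h1 : ∫⁻ y, ENNReal.ofReal (h y) ^ 2 * w y = ∫⁻ y, ENNReal.ofReal (h y) ^ 2 ∂ρ := by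
      rw [hρ, lintegral_withDensity_eq_lintegral_mul _ hwm hmeas]
      exact lintegral_congr fun y => by simp only [Pi.mul_apply]; ring
    rw [h1, hnorm]

end TransferData

/-! ## §3. Existence of the symmetric superstable Gibbs state of a chain -/

/-- **Existence of a shift-invariant, reflection-invariant, superstable DLR Gibbs state of the
chain** (Lebowitz–Presutti 1976, Ruelle 1976; transfer-operator construction of
Cassandro–Olivieri–Pellegrinotti–Presutti 1978 §2 / Georgii 2011 Thm 10.25, §11.1). Let `U`, `V` be
measurable with `U ≥ 0`, `V ≥ 0`, `V` even, `T > 0` and `∫ e^{-U(q)/(2T)} dq < ∞`. Then there is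
a probability measure `μ` on `ℤ → ℝ × ℝ` which is a DLR Gibbs state of the chain at temperature
`T`, translation invariant, satisfies Buttà–Marchioro's superstability estimate (2.3), and is
invariant under the spatial reflection `σ ↦ σ(-·)`: the two-sided stationary Markov chain of the
transfer eigen-data (`exists_transferEigenData`, `exists_markovChainMeasure`) has all four
properties by the tree's window-density theorems. [cite: Georgii2011, Thm 10.25 and §11.1] -/
theorem exists_gibbsState (P : OscillatorChain) (hU : Measurable P.U) (hV : Measurable P.V)
    (hU0 : ∀ r, 0 ≤ P.U r) (hV0 : ∀ r, 0 ≤ P.V r) (hVe : ∀ r, P.V (-r) = P.V r) {T : ℝ}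
    (hT : 0 < T) (hUi2 : Integrable (fun q : ℝ => Real.exp (-(2 * T)⁻¹ * P.U q))) :
    ∃ μ : Measure ChainConfig, P.IsChainGibbsMeasure T μ ∧ IsShiftInvariant μ ∧
      P.HasSuperstabilityEstimate μ ∧ μ.map (fun (σ : ChainConfig) (x : ℤ) => σ (-x)) = μ := by
  classical
  -- `∫ e^{-U/T} < ∞` from `∫ e^{-U/(2T)} < ∞` and `U ≥ 0`
  have hUi : Integrable (fun q : ℝ => Real.exp (-T⁻¹ * P.U q)) := by
    refine hUi2.mono' (Real.measurable_exp.comp (hU.const_mul _)).aestronglyMeasurable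
      (Filter.Eventually.of_forall fun q => ?_)
    rw [Real.norm_eq_abs, abs_of_pos (Real.exp_pos _)]
    refine Real.exp_le_exp.2 ?_
    have h2 : (2 * T)⁻¹ ≤ T⁻¹ := by
      rw [mul_inv, ← one_mul T⁻¹, ← mul_assoc]
      exact mul_le_mul_of_nonneg_right (by norm_num) (inv_nonneg.2 hT.le)
    nlinarith [hU0 q, inv_nonneg.2 hT.le]
  -- the transfer data
  obtain ⟨w, hw⟩ : ∃ w : ℝ × ℝ → ℝ≥0∞,
      ∀ z, w z = ENNReal.ofReal (Real.exp (-T⁻¹ * (z.2 ^ 2 / 2 + P.U z.1))) := ⟨_, fun _ => rfl⟩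
  obtain ⟨k, hk⟩ : ∃ k : ℝ × ℝ → ℝ × ℝ → ℝ≥0∞,
      ∀ z z', k z z' = ENNReal.ofReal (Real.exp (-T⁻¹ * P.V (z'.1 - z.1))) := ⟨_, fun _ _ => rfl⟩
  have hwm : Measurable w := measurable_siteWeightE hU hw
  have hkm : Measurable (uncurry k) := measurable_uncurry_transferKernel hV hk
  have hsym : ∀ z y, k z y = k y z := transferKernel_symm hVe hk
  obtain ⟨φ, L, B, hφm, hL0, hLt, hφB, heig, hnorm⟩ :=
    exists_transferEigenData hU hV hV0 hVe hT hUi hw hk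
  -- the window densities
  obtain ⟨D, hD⟩ : ∃ D : ℤ → ℕ → ChainConfig → ℝ≥0∞, ∀ a n σ, D a n σ =
      φ (σ a) * φ (σ (a + n)) * (∏ j ∈ Finset.range n, k (σ (a + j)) (σ (a + j + 1)) * L⁻¹) *
        ∏ j ∈ Finset.range (n + 1), w (σ (a + j)) := ⟨_, fun _ _ _ => rfl⟩
  -- the Markov chain
  obtain ⟨μ, hprob, hμ⟩ := exists_markovChainMeasure (S := ℝ × ℝ) (ν := (volume : Measure (ℝ × ℝ)))
    hkm hφm hwm hL0 hLt heig hsym hnorm hD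
  haveI := hprob
  refine ⟨μ, ?_, ?_, ?_, ?_⟩
  · exact P.isChainGibbsMeasure_of_windowDensity hU hV hkm hφm hwm hD
      (boltzmannWeight_eq_prod_transfer P T hw hk)
      (fun Λ η => (P.lmarginal_boltzmann_lt_top hT hV0 hUi Λ η).ne) hμ
  · exact isShiftInvariant_of_windowDensity hkm hφm hwm hD hμ
  · exact P.hasSuperstabilityEstimate_of_windowDensity hU hV hT hU0 hV0 hVe hUi2 hw hk hφB hL0 hD hμ
  · exact map_reflect_eq_of_windowDensity' hkm hφm hwm hsym hD hμ

/-! ## §4. The pinned anharmonic chain -/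

/-- **The symmetric superstable Gibbs state of the pinned anharmonic chain exists** (registered
helper stub of `stub_gibbsClustering`; the static half of hypothesis (H) of
`stub_symmetricFramework`): for `ω₂ > 0`, `lam ≥ 0`, `β ≥ 0`, any `γ`, and every `T > 0` there is
a measure on `ℤ → ℝ × ℝ` which is a DLR Gibbs state of `pinnedChain ω₂ lam β γ` at `T`, shift
invariant, superstable (BM (2.3)) and invariant under `σ ↦ σ(-·)` (`U = ω₂q²/2 + lam q⁴/4 ≥ 0`
with Gaussian-dominated `e^{-U/(2T)}`, `V = r²/2 + βr⁴/4 ≥ 0` even). (Lebowitz–Presutti 1976;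
Ruelle 1976; COPP 1978 §2; Georgii 2011 Thm 10.25.) [cite: Georgii2011, Thm 10.25 and §11.1] -/
theorem exists_gibbsState_pinnedChain : ∀ (ω₂ lam β γ : ℝ), 0 < ω₂ → 0 ≤ lam → 0 ≤ β → ∀ (T : ℝ), 0 < T → ∃ μ : MeasureTheory.Measure (ℤ → ℝ × ℝ), (Literature.MathematicalPhysics.KineticTheory.HeatConduction.pinnedChain ω₂ lam β γ).IsChainGibbsMeasure T μ ∧ Literature.MathematicalPhysics.KineticTheory.HeatConduction.IsShiftInvariant μ ∧ (Literature.MathematicalPhysics.KineticTheory.HeatConduction.pinnedChain ω₂ lam β γ).HasSuperstabilityEstimate μ ∧ μ.map (fun (σ : ℤ → ℝ × ℝ) (x : ℤ) => σ (-x)) = μ := by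
  intro ω₂ lam β γ hω hl hβ T hT
  have hUm : Measurable (pinnedChain ω₂ lam β γ).U := by
    show Measurable fun q : ℝ => ω₂ * q ^ 2 / 2 + lam * q ^ 4 / 4
    fun_prop
  have hVm : Measurable (pinnedChain ω₂ lam β γ).V := by
    show Measurable fun r : ℝ => r ^ 2 / 2 + β * r ^ 4 / 4
    fun_prop
  have hU0 : ∀ q, 0 ≤ (pinnedChain ω₂ lam β γ).U q := fun q => by
    show 0 ≤ ω₂ * q ^ 2 / 2 + lam * q ^ 4 / 4
    positivity
  have hV0 : ∀ r, 0 ≤ (pinnedChain ω₂ lam β γ).V r := fun r => by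
    show 0 ≤ r ^ 2 / 2 + β * r ^ 4 / 4
    positivity
  have hVe : ∀ r, (pinnedChain ω₂ lam β γ).V (-r) = (pinnedChain ω₂ lam β γ).V r := fun r => by
    show (-r) ^ 2 / 2 + β * (-r) ^ 4 / 4 = r ^ 2 / 2 + β * r ^ 4 / 4
    ring
  have h2T : 0 < 2 * T := by positivity
  have hUi2 : Integrable (fun q : ℝ => Real.exp (-(2 * T)⁻¹ * (pinnedChain ω₂ lam β γ).U q)) :=
    OscillatorChain.integrable_exp_neg_pinning h2T hω hl β γ
  exact exists_gibbsState (pinnedChain ω₂ lam β γ) hUm hVm hU0 hV0 hVe hT hUi2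

end Summit.AtomisticToContinuum.FouriersLaw.Theorems.MourreDissolution

end
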